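import Literature.NumberTheory.GaloisCohomology.Howard2004.DualityDatumLocalCupAnnihilatorProofs
import HarnessLib

/-!
# The `T`-side (left) double annihilator for Howard's induced local pairing `localCup`, and the symmetry of the
# scalar action under the cup product (proofs)

`Proofs` file (theorems only; no definition, no named fact, no instance, no `sorry`).  MIRROR of x9-p1-w4's
`DualityDatumLocalCupAnnihilatorProofs` §3 (the `Tw T`-side (right) double annihilator
`DualityDatum.mem_of_forall_localCup_annihilator_eq_zero[_of_isPerfect]`).

Howard 2004, H.4 at a finite place `v` [Compositio Math. 140 (2004), §1.3, arXiv:1202.6340 p. 7 L78–82] asks that `F_v` and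
the transport of `F_{v̄}` be EXACT annihilators of each other under `∪ : H¹(K_v, T) × H¹(K_v, Tw T) → H²(K_v, R(1))`; the
descent of the cell's tree (`Tower.mem_levelCondition_top_of_forall_pairing_bot_eq_zero_of_range`, applied once to the
system `(X, Y, B)` and once to the FLIPPED system `(Y, X, B.flip)`) needs the finite-level double-annihilator property on
BOTH sides.  This file supplies the `T`-side one:

* §1 **`DualityDatum.localCup_scalarMapH1_comm`**: `(r • x) ∪ y = x ∪ (r • y)` (`R`-bilinearity of Howard's `e`, through
  `ContPairing.cupProduct_adjoint`), hence `cohomologyMap_expLam_lamMul_localCup_left`: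
  `H²(exp ∘ λ_r)(x ∪ t) = H²(exp ∘ λ)((r • x) ∪ t)` (companion of x9-p1-w4's `cohomologyMap_expLam_lamMul_localCup`);
* §2 **`DualityDatum.mem_of_forall_localCupZMod_annihilator_eq_zero_left`** — `T = T^⊥⊥` for subgroups `T ≤ H¹(K_v, T)` under
  the PERFECT `ℤ/p^k`-reading of `∪` (`Tower.mem_of_forall_pairing_annihilator_eq_zero` for the flipped reading);
* §3 **`DualityDatum.mem_of_forall_localCup_annihilator_eq_zero_left[_of_isPerfect]`** — the same for `localCup` ITSELF at
  `R`-STABLE subgroups `T ≤ H¹(K_v, T)`: if «`∀ y, (∀ t ∈ T, t ∪ y = 0) → x ∪ y = 0`» then `x ∈ T` (read the hypothesis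
  through the dualizing family `λ_{r_i}`, `T` being `r_i`-stable, §1).

Cell `pub/bsd-print-x9` (STUB A `hfin4`, brick (M1) of the custodian's assembly split: the `hPerf` input of the flipped descent
for `hDualX`).  Conditional on the local invariant maps exactly as the right-hand file (`LocalInvariants.IsPerfect`, first
conjunct of the tree's Poitou–Tate named fact).  BSD is not proved by any of this.

References: [Howard2004HeegnerKolyvagin] §1.3 H.4 (arXiv p. 7, L69–82), Def. 1.1.1, Def. 3.2.6; [MilneADT2006] Ch. I §0
Prop. 0.19, Cor. 2.3; [NeukirchSchmidtWingberg2008] I §4 (1.4.2); [SerreGaloisCohomology1997] I §2.2, §5.1.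
-/

set_option autoImplicit false

noncomputable section

open CategoryTheory Function NumberField IsDedekindDomain Field
open scoped ContRepresentation NumberField

namespace Literature.NumberTheory.GaloisCohomology.Howard2004

open Literature.NumberTheory.GaloisRepresentations
open Literature.NumberTheory.GaloisRepresentations.DiscreteGaloisModule
open Literature.NumberTheory.EllipticCurves (Tower.mem_of_forall_pairing_annihilator_eq_zero)

variable {K : Type} [Field K] [NumberField K] {M : Type} [AddCommGroup M] [TopologicalSpace M]
  [DiscreteTopology M] {R : Type} [CommRing R] [Module R M] [TopologicalSpace R] [DiscreteTopology R]
  {p : ℕ} [Fact p.Prime] [Algebra ℤ_[p] R] {cd : ConjugationDatum K} {ρ : DiscreteGaloisModule K M}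
  (D : DualityDatum p cd ρ R) {k : ℕ}
  (lam : R →+ ZMod (p ^ k))
  (hlam : ∀ (z : ℤ_[p]) (r : R), lam (algebraMap ℤ_[p] R z * r) = PadicInt.toZModPow k z * lam r)
  (exp : ZMod (p ^ k) →+ MuCarrier K (p ^ k))
  (hexp : ∀ (g : absoluteGaloisGroup K) (x : ZMod (p ^ k)),
    exp (cyclotomicCharacterModPow K p k g * x) = mu K (p ^ k) g (exp x))

namespace DualityDatum

omit [TopologicalSpace R] [DiscreteTopology R] [Algebra ℤ_[p] R] in
/-- The local module `T|_{Γ_{K_v}}` is `R`-linear when `T` is (`IsScalarLinear.restrictField` at `K_v`; companion of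
`isScalarLinear_twist_toLocal`). [cite: Howard2004HeegnerKolyvagin, §1 conventions and Def. 1.1.1 (local conditions are R-submodules)] -/
theorem isScalarLinear_toLocal {ρ' : DiscreteGaloisModule K M} (hρ' : ρ'.IsScalarLinear R) (v : Place K) :
    IsScalarLinear R (ρ'.toLocal v) :=
  hρ'.restrictField (Place.Completion v)

omit [TopologicalSpace R] [DiscreteTopology R] [Algebra ℤ_[p] R] in
/-- **`hT` of `mem_of_forall_localCup_annihilator_eq_zero_left` for the image of a tower reduction**: with `ρ`, `ρ₂`
`R`-, `R₂`-linear, `r : T₂ → T` equivariant and `φ`-semilinear for a surjective `φ : R₂ → R`, the range of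
`H¹(K_v, r) : H¹(K_v, T₂) → H¹(K_v, T)` is stable under `H¹(r_i •)` for every family `(r_i)` of `R` (companion of
`scalarMapH1_twist_toLocal_mem_range`). [cite: Howard2004HeegnerKolyvagin, §1.3 H.4 and Def. 1.1.1]
[cite: SerreGaloisCohomology1997, Ch. I §2.2 and §5.1] -/
theorem scalarMapH1_toLocal_mem_range {M₂ : Type} [AddCommGroup M₂] [TopologicalSpace M₂]
    [DiscreteTopology M₂] {R₂ : Type} [CommRing R₂] [Module R₂ M₂] {ρ₂ : DiscreteGaloisModule K M₂}
    (hρ : ρ.IsScalarLinear R) (hρ₂ : ρ₂.IsScalarLinear R₂) (r : M₂ →+ M)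
    (hr : ∀ (g : absoluteGaloisGroup K) (m : M₂), r (ρ₂ g m) = ρ g (r m)) (φ : R₂ → R) (hφ : Surjective φ)
    (hsemi : ∀ (a : R₂) (m : M₂), r (a • m) = φ a • r m) (v : Place K) {ι : Type} (rfam : ι → R) (i : ι)
    (t : galoisCohomology (ρ.toLocal v) 1)
    (ht : t ∈ (ContinuousRep.cohomologyMap (ρ₂.toLocal v) (ρ.toLocal v) r
      continuous_of_discreteTopology (fun _ m => hr _ m) 1).range) :
    galoisCohomology.scalarMapH1 (ρ.toLocal v) (isScalarLinear_toLocal hρ v) (rfam i) t ∈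
      (ContinuousRep.cohomologyMap (ρ₂.toLocal v) (ρ.toLocal v) r
        continuous_of_discreteTopology (fun _ m => hr _ m) 1).range :=
  scalarMapH1_mem_range_cohomologyMap_of_surjective (isScalarLinear_toLocal hρ v) (isScalarLinear_toLocal hρ₂ v) r
    (fun _ m => hr _ m) φ hφ hsemi (rfam i) t ht

/-! ## §1 `(r • x) ∪ y = x ∪ (r • y)` and the left reading `H²(exp ∘ λ_r)(x ∪ t) = H²(exp ∘ λ)((r • x) ∪ t)` -/

omit [Algebra ℤ_[p] R] in
/-- **The scalar action is self-adjoint under the induced local pairing**: `(r • x) ∪ y = x ∪ (r • y)` in `H²(K_v, R(1))`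
for `x ∈ H¹(K_v, T)`, `y ∈ H¹(K_v, Tw T)` — Howard's `e` is `R`-bilinear (`e(r s, t) = r e(s, t) = e(s, r t)`), and the cup
product is adjoint-natural (`ContPairing.cupProduct_adjoint`). [cite: Howard2004HeegnerKolyvagin, §1.3 H.4 (arXiv p. 7, L69–76: e is R-bilinear)]
[cite: NeukirchSchmidtWingberg2008, I §4 (1.4.2)] -/
theorem localCup_scalarMapH1_comm {p' : ℕ} [Fact p'.Prime] [Algebra ℤ_[p'] R] (D' : DualityDatum p' cd ρ R)
    (v : Place K) (hρv : (ρ.toLocal v).IsScalarLinear R) (hρv' : ((cd.twist ρ).toLocal v).IsScalarLinear R) (r : R)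
    (x : galoisCohomology (ρ.toLocal v) 1) (y : galoisCohomology ((cd.twist ρ).toLocal v) 1) :
    D'.localCup v (galoisCohomology.scalarMapH1 (ρ.toLocal v) hρv r x) y =
      D'.localCup v x (galoisCohomology.scalarMapH1 ((cd.twist ρ).toLocal v) hρv' r y) := by
  haveI : CompactSpace (absoluteGaloisGroup (Place.Completion v)) := absoluteGaloisGroup_compactSpace _
  let α : (ρ.toLocal v).toTopRep ⟶ (ρ.toLocal v).toTopRep := TopRep.ofHom (scalarIntertwining (ρ.toLocal v) hρv r)
  let β : ((cd.twist ρ).toLocal v).toTopRep ⟶ ((cd.twist ρ).toLocal v).toTopRep :=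
    TopRep.ofHom (scalarIntertwining ((cd.twist ρ).toLocal v) hρv' r)
  have h := ContPairing.cupProduct_adjoint (D'.ePairingLocal v) (D'.ePairingLocal v) α β (fun s t => by
    change D'.e (r • s) t = D'.e s (r • t)
    rw [map_smul, LinearMap.smul_apply, map_smul]) x y
  exact h

/-- **`H²(exp ∘ λ_r)(x ∪ t) = H²(exp ∘ λ)((r • x) ∪ t)`** — the `T`-side companion of x9-p1-w4's
`cohomologyMap_expLam_lamMul_localCup` (there the scalar is moved onto `t`), by §1's symmetry.
[cite: Howard2004HeegnerKolyvagin, §1.3 H.4 (arXiv p. 7, L78–82)] [cite: NeukirchSchmidtWingberg2008, I §4 (1.4.2)] -/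
theorem cohomologyMap_expLam_lamMul_localCup_left [Finite M] (hρ : ρ.IsScalarLinear R) (v : Place K) (r : R)
    (x : galoisCohomology (ρ.toLocal v) 1) (t : galoisCohomology ((cd.twist ρ).toLocal v) 1) :
    cohomologyMap (D.expLamLocalHom (lamMul lam r) (lamMul_semilinear lam hlam r) exp hexp v) 2 (D.localCup v x t) =
      cohomologyMap (D.expLamLocalHom lam hlam exp hexp v) 2
        (D.localCup v (galoisCohomology.scalarMapH1 (ρ.toLocal v) (isScalarLinear_toLocal hρ v) r x) t) := by
  rw [D.cohomologyMap_expLam_lamMul_localCup lam hlam exp hexp hρ v r x t,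
    D.localCup_scalarMapH1_comm v (isScalarLinear_toLocal hρ v) (isScalarLinear_twist_toLocal cd hρ v) r x t]

/-! ## §2 (Perf, left) under the `ℤ/p^k`-reading -/

/-- **(Perf, left): the double annihilator of a subgroup of `H¹(K_v, T)` under the `ℤ/p^k`-reading of the induced local
pairing.**  At a finite place `v`, for `T` finite killed by `p^k`, `Θ` bijective and `ι_v` making the local Tate pairing of `T`
non-degenerate on both sides: if `x ∈ H¹(K_v, T)` pairs to zero with every `y` annihilating the subgroup `𝒯 ≤ H¹(K_v, T)`, then
`x ∈ 𝒯` (`Tower.mem_of_forall_pairing_annihilator_eq_zero` for the flipped reading; `#𝒯^⊥ · #𝒯 = #H¹`).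
[cite: Howard2004HeegnerKolyvagin, §1.3 H.4 and Def. 3.2.6] [cite: MilneADT2006, Ch. I, Cor. 2.3 and Prop. 0.19] -/
theorem mem_of_forall_localCupZMod_annihilator_eq_zero_left [Finite M] (hM : ∀ m : M, (p ^ k) • m = 0)
    (hΘ : Bijective (D.toTateDual lam hlam exp hexp)) (v : HeightOneSpectrum (𝓞 K))
    (ι : galoisCohomology ((mu K (p ^ k)).toLocal (Sum.inr v)) 2 →+ ZMod (p ^ k))
    (hι : Injective (localTatePairingZMod ρ (p ^ k) (Sum.inr v) ι))
    (hι' : Injective (localTatePairingZMod ρ (p ^ k) (Sum.inr v) ι).flip)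
    (𝒯 : AddSubgroup (galoisCohomology (ρ.toLocal (Sum.inr v)) 1))
    (x : galoisCohomology (ρ.toLocal (Sum.inr v)) 1)
    (hx : ∀ y : galoisCohomology ((cd.twist ρ).toLocal (Sum.inr v)) 1,
      (∀ t ∈ 𝒯, ι (cohomologyMap (D.expLamLocalHom lam hlam exp hexp (Sum.inr v)) 2 (D.localCup (Sum.inr v) t y)) = 0) →
        ι (cohomologyMap (D.expLamLocalHom lam hlam exp hexp (Sum.inr v)) 2 (D.localCup (Sum.inr v) x y)) = 0) :
    x ∈ 𝒯 := by
  haveI : NeZero (p ^ k) := ⟨pow_ne_zero k (Fact.out : p.Prime).ne_zero⟩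
  haveI := finite_galoisCohomology_one_toLocal ρ v
  haveI := finite_galoisCohomology_one_toLocal (cd.twist ρ) v
  refine Tower.mem_of_forall_pairing_annihilator_eq_zero
    ((localTatePairingZMod ρ (p ^ k) (Sum.inr v) ι).compl₂
      (galoisCohomology.map (Literature.NumberTheory.EllipticCurves.DiscreteGaloisModule.localMap
        (D.toTateDual lam hlam exp hexp) (Sum.inr v)) 1)).flip
    (fun y ↦ galoisCohomology.nsmul_eq_zero_of_forall _ hM y)
    (fun x ↦ galoisCohomology.nsmul_eq_zero_of_forall _ hM x)
    (D.injective_localCupZMod_flip lam hlam exp hexp hΘ _ ι hι')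
    (fun a a' h ↦ D.injective_localCupZMod lam hlam exp hexp hΘ _ ι hι
      (AddMonoidHom.ext fun y' ↦ DFunLike.congr_fun h y'))
    𝒯 x fun y hy ↦ ?_
  rw [AddMonoidHom.flip_apply, ← D.localCupZMod_apply lam hlam exp hexp]
  exact hx y fun t ht ↦ by rw [D.localCupZMod_apply lam hlam exp hexp]; exact hy t ht

/-! ## §3 (Perf, left) for `localCup` itself at `R`-stable subgroups -/

section Perfect

variable [Finite M] (hρ : ρ.IsScalarLinear R) (v : HeightOneSpectrum (𝓞 K))

/-- **(Perf, left) The double annihilator of an `R`-stable subgroup of `H¹(K_v, T)`, for `localCup` itself.**  Let `(r_i)` be a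
dualizing family of `R` for `(λ, exp)`, `ι_v : H²(K_v, μ_{p^k}) → ℤ/p^k` with both adjoints of `ι_v ⟨·, ·⟩_v` injective, `Θ`
bijective, and `T ≤ H¹(K_v, T)` a subgroup stable under every `r_i •`.  If `x` satisfies «`∀ y, (∀ t ∈ T, t ∪ y = 0) → x ∪ y = 0`»
then `x ∈ T` — the hypothesis (Perf) of the FLIPPED `Tower.mem_levelCondition_top_of_forall_pairing_bot_eq_zero_of_range`.
[cite: MilneADT2006, Ch. I §0 Prop. 0.19 and Cor. 2.3]
[cite: Howard2004HeegnerKolyvagin, §1.3 H.4 (arXiv p. 7, L78–82) and Def. 1.1.1 (local conditions are R-submodules)] -/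
theorem mem_of_forall_localCup_annihilator_eq_zero_left (hM : ∀ m : M, (p ^ k) • m = 0)
    (hΘ : Bijective (D.toTateDual lam hlam exp hexp))
    (ι₀ : galoisCohomology ((mu K (p ^ k)).toLocal (Sum.inr v : Place K)) 2 →+ ZMod (p ^ k)) (hι₀ : Injective ι₀)
    (hιL : Injective (localTatePairingZMod ρ (p ^ k) (Sum.inr v) ι₀))
    (hιR : Injective (localTatePairingZMod ρ (p ^ k) (Sum.inr v) ι₀).flip)
    {ι : Type} [Finite ι] (r : ι → R) (hbij : Bijective fun x : R => fun i : ι => exp (lam (r i * x)))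
    (T : AddSubgroup (galoisCohomology (ρ.toLocal (Sum.inr v)) 1))
    (hT : ∀ i, ∀ t ∈ T, galoisCohomology.scalarMapH1 (ρ.toLocal (Sum.inr v))
      (isScalarLinear_toLocal hρ (Sum.inr v)) (r i) t ∈ T)
    (x : galoisCohomology (ρ.toLocal (Sum.inr v)) 1)
    (hx : ∀ y : galoisCohomology ((cd.twist ρ).toLocal (Sum.inr v)) 1,
      (∀ t ∈ T, D.localCup (Sum.inr v) t y = 0) → D.localCup (Sum.inr v) x y = 0) :
    x ∈ T := by
  refine D.mem_of_forall_localCupZMod_annihilator_eq_zero_left lam hlam exp hexp hM hΘ v ι₀ hιL hιR T x fun y hy ↦ ?_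
  -- `T ⊥ y` under the reading ⇒ `t ∪ y = 0` for all `t ∈ T` (readout through the family `λ_{r_i}`, `T` being `r_i`-stable)
  have hTy : ∀ t ∈ T, D.localCup (Sum.inr v) t y = 0 := fun t ht ↦ by
    refine D.eq_zero_of_forall_cohomologyMap_expLam_lamMul_eq_zero lam hlam exp hexp r hbij (Sum.inr v) _ fun i ↦ ?_
    rw [D.cohomologyMap_expLam_lamMul_localCup_left lam hlam exp hexp hρ]
    exact hι₀ ((hy _ (hT i t ht)).trans (map_zero _).symm)
  rw [hx y hTy]
  exact (congrArg ι₀ (map_zero _)).trans (map_zero _)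

/-- **(Perf, left) for `localCup` itself from the Poitou–Tate family**: with `inv : LocalInvariants K (p^k)` satisfying
`IsPerfect` (first conjunct of `poitouTate_selmerStructure_duality K`). [cite: MilneADT2006, Ch. I §0 Prop. 0.19 and Cor. 2.3]
[cite: Howard2004HeegnerKolyvagin, §1.3 H.4 (arXiv p. 7, L78–82) and Def. 1.1.1] -/
theorem mem_of_forall_localCup_annihilator_eq_zero_left_of_isPerfect (hM : ∀ m : M, (p ^ k) • m = 0)
    (hΘ : Bijective (D.toTateDual lam hlam exp hexp)) (inv : LocalInvariants K (p ^ k)) (hperf : inv.IsPerfect)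
    {ι : Type} [Finite ι] (r : ι → R) (hbij : Bijective fun x : R => fun i : ι => exp (lam (r i * x)))
    (T : AddSubgroup (galoisCohomology (ρ.toLocal (Sum.inr v)) 1))
    (hT : ∀ i, ∀ t ∈ T, galoisCohomology.scalarMapH1 (ρ.toLocal (Sum.inr v))
      (isScalarLinear_toLocal hρ (Sum.inr v)) (r i) t ∈ T)
    (x : galoisCohomology (ρ.toLocal (Sum.inr v)) 1)
    (hx : ∀ y : galoisCohomology ((cd.twist ρ).toLocal (Sum.inr v)) 1,
      (∀ t ∈ T, D.localCup (Sum.inr v) t y = 0) → D.localCup (Sum.inr v) x y = 0) :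
    x ∈ T :=
  D.mem_of_forall_localCup_annihilator_eq_zero_left lam hlam exp hexp hρ v hM hΘ _ (hperf v).1.1 ((hperf v).2 ρ hM).1.1
    ((hperf v).2 ρ hM).2.1 r hbij T hT x hx

end Perfect

end DualityDatum

end Literature.NumberTheory.GaloisCohomology.Howard2004

end
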